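import Summits.CriticalPhenomena.PercolationContinuityZ3.Theorems.PercNearOneGluingNoHeavyQuantDIBStarFloorSplitInductionCore
import Summits.CriticalPhenomena.PercolationContinuityZ3.Theorems.PercNearOneGluingNoHeavyQuantStepFSE
import HarnessLib

/-!
# QUANT lane R8, Conjecture DIB\* — the lead's FOUR CELLS of the FS step TYPED (LEAD-NOTES-G18 N35 (4)(c)/(7)): the minimal complete menu
# `open ∈ {∨, ε} × closed ∈ {∧, ε}` on the core class, as a refinement of `FSMenuE`; `StepFSECells ⟹ StepLemmaFSCore ⟹ ∀ x < 1, DIBStar x`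

builds on p205010 (kernel theorem, internal audit signed; external expert review pending)

Statement + support file (`--supports stmt-CriticalPhenomena-4575`), QUANT lane typer seat prim-quant-stmt (gen 20), rung R8 of
`run/shared/lean/prim/quant/LADDER.md`; lead g18's optional ask (lane INBOX 11:15Z: "the four cell predicates of N35 (7) as a refinement of `FSMenuE` once
InductionCore lands; do not re-declare `StepLemmaFSCore`").  FOUR `Prop` definitions (`RootDec.CertOr`, `CertAnd`, `CertEps` — three items of `FSMenuE` named — and the
`@[conjecture]` `IndepBlob.StepFSECells`), theorems otherwise; no sorries, standard axioms.

THE DATA (lead g18, N35 (4)): on the 2 158 tight H/L instances of explore/t10 and on the exact cell map (kit j130204/j130205, 469 335 hard instances; 8.77 M in all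
runs, 0 failures of the single split on the largest blob) the MINIMAL COMPLETE MENU for the split on `k = MAXSIZE` is `open ∈ {∨, ε} × closed ∈ {∧, ε}` — the four cells
(∨,∧) [lumpy / near-giant; contains the S7/9 family], (∨,ε), (ε,∧) [rare], (ε,ε) [smooth]; γ, Markov, α′ add nothing (same minimal margin 0.183); 'ε on both branches
always' is a coarse-grid artefact (35 failures on near-giant triples) and is NOT typed.

* `Quant.RootDec.CertOr z s a g j` (∨: a finset of giants with `z ≤ 1 − ∏(1 − g)`), `CertAnd` (∧: a witness finset reaching the level with `z ≤ ∏ g`), `CertEps` (ε: Cantelli)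
  — each implies `FSMenuE z s a g j` (`fsMenuE_of_certOr/And/Eps`), hence is sound (`term_ge_of_fsMenuE`).
* **`Quant.IndepBlob.StepFSECells`** (`@[conjecture]`) — for every instance of the CORE class (the hypotheses of lead g18's `StepLemmaFSCore` without the inductive rows:
  `1/2 < x < 1`, gates in `[0,1]`, light sizes `≤ j`, heavy total `≤ 2j`, no heavy giant, two non-empty lights, light total `≥ j+1`, no dead light, no sure blob of maximal
  size, credit `> 2j`) and EVERY blob `k` of maximal size and maximal gate among those: `∃ z₁ z₀, x ≤ g k·z₁ + (1 − g k)·z₀` with the open branch certified by ∨ or ε and the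
  closed branch by ∧ or ε.  Stronger than `StepFSEMax` restricted to the core class; refutable by ONE instance.
* **`stepLemmaFSCore_of_cells : StepFSECells → StepLemmaFSCore`** (choose such a `k`, rule φ with the two menu-E certificates; the inductive rows are not used) and
  **`dibStar_of_stepFSECells : StepFSECells → ∀ x < 1, DIBStar x`**.
[this work; conjecture and census: prim-quant-lead g18 (this lane)]; the gluing rows served [cite: KozmaNitzan2024, Conjecture 3 (p. 15)].
-/

namespace Summit.CriticalPhenomena.PercolationContinuityZ3.Theorems

namespace Quant

namespace RootDec

open Finset

variable {κ : Type} [Fintype κ]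

/-- **Cell item ∨** (disjunction of giants): some finset `G` of blobs each completing the sure part (`j + 1 ≤ s + a k`) with `z ≤ 1 − ∏_{G}(1 − g)`. [this work] -/
def CertOr (z : ℝ) (s : ℕ) (a : κ → ℕ) (g : κ → ℝ) (j : ℕ) : Prop :=
  ∃ G : Finset κ, (∀ k ∈ G, j + 1 ≤ s + a k) ∧ z ≤ 1 - ∏ k ∈ G, (1 - g k)

/-- **Cell item ∧** (one witness set): some finset `S` with `j + 1 ≤ s + Σ_{S} a` and `z ≤ ∏_{S} g`. [this work] -/
def CertAnd (z : ℝ) (s : ℕ) (a : κ → ℕ) (g : κ → ℝ) (j : ℕ) : Prop :=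
  ∃ S : Finset κ, j + 1 ≤ s + ∑ k ∈ S, a k ∧ z ≤ ∏ k ∈ S, g k

/-- **Cell item ε** (Cantelli with the exact mean `m = Σ a g` and variance `V = Σ a² g (1 − g)`): `s ≤ j`, `j − s < m`, `z ≤ 1 − V/(V + (m − (j − s))²)`. [this work] -/
def CertEps (z : ℝ) (s : ℕ) (a : κ → ℕ) (g : κ → ℝ) (j : ℕ) : Prop :=
  s ≤ j ∧ ((j - s : ℕ) : ℝ) < ∑ k, (a k : ℝ) * g k ∧
    z ≤ 1 - (∑ k, (a k : ℝ) ^ 2 * g k * (1 - g k)) /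
      ((∑ k, (a k : ℝ) ^ 2 * g k * (1 - g k)) + ((∑ k, (a k : ℝ) * g k) - ((j - s : ℕ) : ℝ)) ^ 2)

/-- ∨ is an item of menu E. [this work] -/
theorem fsMenuE_of_certOr (z : ℝ) (s : ℕ) (a : κ → ℕ) (g : κ → ℝ) (j : ℕ) (h : CertOr z s a g j) : FSMenuE z s a g j :=
  Or.inr (Or.inr (Or.inr (Or.inl h)))

/-- ∧ is an item of menu E. [this work] -/
theorem fsMenuE_of_certAnd (z : ℝ) (s : ℕ) (a : κ → ℕ) (g : κ → ℝ) (j : ℕ) (h : CertAnd z s a g j) : FSMenuE z s a g j :=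
  Or.inr (Or.inr (Or.inr (Or.inr (Or.inl h))))

/-- ε is an item of menu E. [this work] -/
theorem fsMenuE_of_certEps (z : ℝ) (s : ℕ) (a : κ → ℕ) (g : κ → ℝ) (j : ℕ) (h : CertEps z s a g j) : FSMenuE z s a g j :=
  Or.inr (Or.inr (Or.inr (Or.inr (Or.inr h))))

end RootDec

namespace IndepBlob

open Finset

/-- **CONJECTURE — THE FOUR CELLS OF THE FS STEP (lead g18, N35 (4)(c)/(7)).**  For every instance of the core class (`StepLemmaFSCore`'s hypotheses without the
inductive rows) and every blob `k` of maximal size whose gate is maximal among the blobs of maximal size, there are floors `z₁, z₀` with `x ≤ g k·z₁ + (1 − g k)·z₀`,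
the OPEN branch (`a[k ↦ 0]`, sure part `a k`) certified by ∨ or ε and the CLOSED branch (`a[k ↦ 0]`, sure part `0`) by ∧ or ε.  Evidence: 8.77 M exact hard
instances + 2 158 tight H/L instances, 0 failures, minimal normalised margin 0.183 (the same as the full menu's).  builds on p205010 (kernel theorem, internal audit
signed; external expert review pending). [this work] [status: open] -/
@[conjecture] def StepFSECells : Prop :=
  ∀ (κ : Type) [Fintype κ] [DecidableEq κ] (a : κ → ℕ) (g : κ → ℝ) (j : ℕ) (x : ℝ),
    1 / 2 < x → x < 1 →
    (∀ k, 0 ≤ g k ∧ g k ≤ 1) →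
    (∀ k, g k < x → a k ≤ j) →
    (∑ k ∈ Finset.univ.filter (fun k => x ≤ g k), a k ≤ 2 * j) →
    (∀ k, x ≤ g k → a k ≤ j) →
    (∃ k₁ k₂, k₁ ≠ k₂ ∧ g k₁ < x ∧ 0 < a k₁ ∧ g k₂ < x ∧ 0 < a k₂) →
    (j + 1 ≤ ∑ k ∈ Finset.univ.filter (fun k => g k < x), a k) →
    (∀ k, g k < x → 0 < a k → x ^ 2 < g k) →
    (∀ k, (∀ i, a i ≤ a k) → g k < 1) →
    (2 * j : ℝ) < ∑ k, (a k : ℝ) * (if x ≤ g k then g k else (g k - x ^ 2) / (1 - x)) →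
    ∀ k : κ, (∀ i, a i ≤ a k) → (∀ i, a i = a k → g i ≤ g k) →
      ∃ z₁ z₀ : ℝ, x ≤ g k * z₁ + (1 - g k) * z₀ ∧
        (RootDec.CertOr z₁ (a k) (Function.update a k 0) g j ∨ RootDec.CertEps z₁ (a k) (Function.update a k 0) g j) ∧
        (RootDec.CertAnd z₀ 0 (Function.update a k 0) g j ∨ RootDec.CertEps z₀ 0 (Function.update a k 0) g j)

/-- **The four cells imply the core step lemma** (choose a blob of maximal size and maximal gate among those; rule φ with the two menu-E certificates; the
inductive rows of `StepLemmaFSCore` are not used). [this work] -/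
theorem stepLemmaFSCore_of_cells (H : StepFSECells) : StepLemmaFSCore := by
  intro κ _ _ a g j x hx hx1 hg hlight hcorner hnogiant htwo hbig hnodead hnosure hcredit _
  obtain ⟨k₁', _, _, _, hk₁'a, _, _⟩ := id htwo
  obtain ⟨k₁, _, hk₁⟩ := Finset.exists_max_image (Finset.univ : Finset κ) a ⟨k₁', Finset.mem_univ _⟩
  obtain ⟨k, hkT, hk⟩ := Finset.exists_max_image (Finset.univ.filter fun i => a i = a k₁) g
    ⟨k₁, Finset.mem_filter.2 ⟨Finset.mem_univ _, rfl⟩⟩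
  have hak : a k = a k₁ := (Finset.mem_filter.1 hkT).2
  have hmax : ∀ i, a i ≤ a k := fun i => hak ▸ hk₁ i (Finset.mem_univ i)
  have hgate : ∀ i, a i = a k → g i ≤ g k := fun i hi =>
    hk i (Finset.mem_filter.2 ⟨Finset.mem_univ i, hi.trans hak⟩)
  obtain ⟨z₁, z₀, hconv, h₁, h₀⟩ := H κ a g j x hx hx1 hg hlight hcorner hnogiant htwo hbig hnodead hnosure hcredit k hmax hgate
  have hm₁ : RootDec.FSMenuE z₁ (0 + a k) (Function.update a k 0) g j := by
    rw [zero_add]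
    rcases h₁ with h | h
    · exact RootDec.fsMenuE_of_certOr _ _ _ g j h
    · exact RootDec.fsMenuE_of_certEps _ _ _ g j h
  have hm₀ : RootDec.FSMenuE z₀ 0 (Function.update a k 0) g j := by
    rcases h₀ with h | h
    · exact RootDec.fsMenuE_of_certAnd _ _ _ g j h
    · exact RootDec.fsMenuE_of_certEps _ _ _ g j h
  have key := RootDec.term_ge_of_floorSplit_menuE 0 a g j k x z₁ z₀ hg hconv hm₁ hm₀
  exact key.trans (le_of_eq (Finset.sum_congr rfl fun W _ => by rw [zero_add]))

/-- **The four cells imply Conjecture DIB\* at every floor `x < 1`** (through lead g18's `dibStar_of_stepLemmaFSCore`). [this work] -/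
theorem dibStar_of_stepFSECells (H : StepFSECells) (x : ℝ) (hx1 : x < 1) : DIBStar x :=
  dibStar_of_stepLemmaFSCore (stepLemmaFSCore_of_cells H) x hx1

end IndepBlob

end Quant

end Summit.CriticalPhenomena.PercolationContinuityZ3.Theorems
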